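import Summits.HodgeConjecture.HodgeConjecture.Theorems.K2E5LieGramDetValue   -- ★ (1∕2) `lieGramDetC_pos_iff`, and through it ★ `skewC`, `traceFormC`, `lieGramC`, `lieGramDetC`, `lieStdLebesgueC(_eq_smul_addHaar)`
import HarnessLib

/-!
# K2 ∕ E5 «TamagawaUnitary» — FILE `K2E5LieGramDetValueIndefinite` (2∕2): THE TRACE-FORM GRAM DETERMINANT OF `𝔲(1,1) = 𝔲(J₋)`, `J₋ = diag(1, −1)`, AT A COMPLEX
# PLACE IS `+4` IN MATRIX-ENTRY COORDINATES, AND `λ_{𝔲(1,1)} = 2 · da db dz` — the indefinite-signature half of the Gram input of socket F9 `sig_K2E5BetaArchPinConstant`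
# (E5 HANDOVER §6.6 RISK #3; companion of `Theorems/K2E5LieGramDetValue.lean`, split off for the 400-line rule)

Cell `pub/hodgecm-mathlib`, Track B «K2-LIT», engine E5, crux H413 = `stmt-HodgeConjecture-24833`, route of record `route-HodgeConjecture-HCCMUnconditional`;
deal (c) of K2E3-plan (g1) 2026-09-03T23:27:26Z (successor E5 dealer); prover seat hodgecm-mathlib-K2E5-p22 (g2).  THEOREMS ONLY (no `def`, no `instance`, no
`notation`, no named-fact hypothesis, no `sorry`); imports = ★ Theorems (1∕2) + HarnessLib; lane `--supports stmt-HodgeConjecture-24833 --as helper`.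

THE MATHEMATICS.  `𝔲(J₋) = {X | Xᴴ J₋ + J₋ X = 0} = {!![ia, z; z̄, ib] | a b : ℝ, z : ℂ}` (`mem_skewC_two_diag`, `eq_of_mem_skewC_two_diag`; entrywise `conj(X j i)·d j + d i·X i j = 0`,
`d = (1, −1)`); in the coordinates `ψ₋ : (a, b, z) ↦ !![ia, z; z̄, ib]` the trace form reads `Re tr(XX′) = −(aa′ + bb′) + 2 Re(z z̄′)` (`traceFormC_coord_two_diag`), so the
coordinate basis `diag(i,0), diag(0,i), !![0,1;1,0], !![0,i;−i,0]` has Gram matrix `diag(−1,−1,+2,+2)` (the `𝔨 = 𝔲(1) ⊕ 𝔲(1)` directions negative, the `𝔭`-plane positive)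
and determinant `+4` (`exists_basis_two_diag`); hence the Gram determinant of record is POSITIVE (`lieGramDetC_two_diag_pos`, via ★ (1∕2) `lieGramDetC_pos_iff`) and the
top-form Lebesgue measure is **`lieStdLebesgueC 2 J₋ = 2 · ψ₋_*(da db dz)`** (`lieStdLebesgueC_two_diag_eq`, ★ `lieStdLebesgueC_eq_smul_addHaar`) — the SAME factor `2` as
for the definite form `1₂` (★ (1∕2) `lieStdLebesgueC_two_one_eq`): the Gram input of F9 does not depend on the signature of `h` at the complex place.  Any non-degenerate
hermitian `2 × 2` form is congruent to `±1₂` or `J₋`; the transport is ★ `UnitaryArchLocalSkewCongr.map_conjEquiv_lieStdLebesgueC` ∕ ★ `exists_formMul_equiv_map_lieStdLebesgueC`.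

HONEST LABEL.  HC_CM is proved only modulo the 7 printed citations (2 remaining named inputs: hLiu418 = `stmt-HodgeConjecture-24832`, h413 = `stmt-HodgeConjecture-24833`)
until rung 0 closes; this file moves no counter.

## References
* [Knapp2002] A. W. Knapp, *Lie Groups Beyond an Introduction*, 2nd ed., Birkhäuser (2002), I §1 (`𝔲(p,q)`), VIII §2.
* [Helgason2000] S. Helgason, *Groups and Geometric Analysis*, AMS (2000), Introduction §4 (`SU(1,1)`), Ch. I §1 Thm. 1.14.
* [Macdonald1980] I. G. Macdonald, *The volume of a compact Lie group*, Invent. Math. 56 (1980), 93–95.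
* [Rogawski1990] J. D. Rogawski, *Automorphic Representations of Unitary Groups in Three Variables*, Ann. of Math. Stud. 123 (1990), §1.7 p. 6.
-/

set_option autoImplicit false
-- the mandated namespace repeats the single-problem summit's segment (`HodgeConjecture.HodgeConjecture`)
set_option linter.dupNamespace false
-- submodule-normed vs subtype topologies on `↥(skewC …)` under the `[BorelSpace ↥(skewC …)]` binder (as in the ★ `UnitaryArchLocal*` files)
set_option backward.isDefEq.respectTransparency false

noncomputable section

open Set MeasureTheory MeasureTheory.Measure Module Matrix Complex
open scoped Classical Matrix Matrix.Norms.Operator MatrixGroups ENNReal NNReal Pointwise ComplexConjugate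
open Literature.NumberTheory.Weil1964.UnitaryArchLocalTopForm

namespace Summit.HodgeConjecture.HodgeConjecture.Cruxes.H413.K2E5LieGramDetValueIndefinite

open Summit.HodgeConjecture.HodgeConjecture.Cruxes.H413.K2E5LieGramDetValue

/-! ## `N = 2`, `Jw = J₋ = diag(1, −1)` (indefinite): Gram `diag(−1,−1,+2,+2)`, det `4`, `λ = 2 · da db dz` -/

section TwoDiag

/-- The entry relations of `𝔲(J₋)`, `J₋ = diag(1,−1)`: `conj(X j i)·d j + d i·X i j = 0` (`d = (1, −1)`). [cite: Helgason2000, Introduction §4] [cite: Knapp2002, I §1] -/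
theorem conj_apply_mul_add_mul_apply_eq_zero_of_mem_skewC_two_diag {X : Matrix (Fin 2) (Fin 2) ℂ}
    (hX : X ∈ skewC 2 (Matrix.diagonal ![(1 : ℂ), -1])) (i j : Fin 2) :
    conj (X j i) * ![(1 : ℂ), -1] j + ![(1 : ℂ), -1] i * X i j = 0 := by
  rw [mem_skewC_iff] at hX
  have h := congrFun (congrFun hX i) j
  rw [Matrix.add_apply, Matrix.mul_diagonal, Matrix.diagonal_mul, Matrix.conjTranspose_apply, Matrix.zero_apply] at h
  exact h

/-- The coordinate matrices `!![ia, z; z̄, ib]` (`a b : ℝ`, `z : ℂ`) lie in `𝔲(J₋)`, `J₋ = diag(1,−1)`. [cite: Helgason2000, Introduction §4] [cite: Knapp2002, I §1] -/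
theorem mem_skewC_two_diag (a b : ℝ) (z : ℂ) :
    !![(a : ℂ) * I, z; conj z, (b : ℂ) * I] ∈ skewC 2 (Matrix.diagonal ![(1 : ℂ), -1]) := by
  rw [mem_skewC_iff]
  ext i j
  rw [Matrix.add_apply, Matrix.mul_diagonal, Matrix.diagonal_mul, Matrix.conjTranspose_apply, Matrix.zero_apply]
  fin_cases i <;> fin_cases j <;> simp [Complex.conj_ofReal]

/-- Every element of `𝔲(J₋)` is a coordinate matrix `!![ia, z; z̄, ib]` with `a = Im X₀₀`, `b = Im X₁₁`, `z = X₀₁`. [cite: Helgason2000, Introduction §4] [cite: Knapp2002, I §1] -/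
theorem eq_of_mem_skewC_two_diag {X : Matrix (Fin 2) (Fin 2) ℂ} (hX : X ∈ skewC 2 (Matrix.diagonal ![(1 : ℂ), -1])) :
    X = !![((X 0 0).im : ℂ) * I, X 0 1; conj (X 0 1), ((X 1 1).im : ℂ) * I] := by
  have h00 := conj_apply_mul_add_mul_apply_eq_zero_of_mem_skewC_two_diag hX 0 0
  have h10 := conj_apply_mul_add_mul_apply_eq_zero_of_mem_skewC_two_diag hX 1 0
  have h11 := conj_apply_mul_add_mul_apply_eq_zero_of_mem_skewC_two_diag hX 1 1
  simp only [Fin.isValue, Matrix.cons_val_zero, Matrix.cons_val_one, mul_one, one_mul, mul_neg, neg_mul] at h00 h10 h11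
  ext i j
  fin_cases i <;> fin_cases j
  · -- `(0,0)`: `conj x + x = 0`
    have hre : (X 0 0).re = 0 := by
      have h := congrArg Complex.re h00
      rw [Complex.add_re, Complex.conj_re, Complex.zero_re] at h
      linarith
    simp only [Fin.zero_eta, Fin.isValue, of_apply, cons_val', cons_val_zero, cons_val_fin_one]
    apply Complex.ext
    · rw [hre, Complex.re_ofReal_mul, Complex.I_re, mul_zero]
    · rw [Complex.im_ofReal_mul, Complex.I_im, mul_one]
  · simp
  · -- `(1,0)`: `conj (X 0 1) - X 1 0 = 0`
    simp only [Fin.mk_one, Fin.isValue, Fin.zero_eta, of_apply, cons_val', cons_val_zero, cons_val_one, cons_val_fin_one]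
    have h : conj (X 0 1) + -X 1 0 = 0 := h10
    rw [add_neg_eq_zero] at h
    exact h.symm
  · -- `(1,1)`: `-conj x - x = 0`
    have hre : (X 1 1).re = 0 := by
      have h := congrArg Complex.re h11
      rw [Complex.add_re, Complex.neg_re, Complex.neg_re, Complex.conj_re, Complex.zero_re] at h
      linarith
    simp only [Fin.mk_one, Fin.isValue, of_apply, cons_val', cons_val_one, cons_val_fin_one]
    apply Complex.ext
    · rw [hre, Complex.re_ofReal_mul, Complex.I_re, mul_zero]
    · rw [Complex.im_ofReal_mul, Complex.I_im, mul_one]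

/-- **The trace form of `𝔲(1,1) = 𝔲(J₋)` in coordinates**: `Re tr(!![ia, z; z̄, ib] · !![ia′, z′; z̄′, ib′]) = −(aa′ + bb′) + 2 Re(z z̄′)` — Gram matrix of the coordinate basis
`diag(i,0), diag(0,i), !![0,1;1,0], !![0,i;−i,0]` is `diag(−1,−1,+2,+2)`, determinant `4` (the `𝔨`-directions negative, the `𝔭`-plane positive).
[cite: Knapp2002, I §1] [cite: Helgason2000, Introduction §4] -/
theorem traceFormC_coord_two_diag (a b a' b' : ℝ) (z z' : ℂ) :
    traceFormC 2 !![(a : ℂ) * I, z; conj z, (b : ℂ) * I] !![(a' : ℂ) * I, z'; conj z', (b' : ℂ) * I] =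
      -(a * a' + b * b') + 2 * (z.re * z'.re + z.im * z'.im) := by
  rw [traceFormC_apply, Matrix.trace_fin_two]
  simp [Matrix.mul_apply, Fin.sum_univ_two, Complex.mul_re, Complex.mul_im]
  ring

/-- The coordinate basis of `𝔲(J₋)`, as an existence statement: a basis `B` indexed by `(Fin 1 ⊕ Fin 1) ⊕ Fin 2` with Gram determinant `4` (for every `DecidableEq`
instance) whose `addHaar` is `da db dz` pushed along `ψ₋ : (a,b,z) ↦ !![ia, z; z̄, ib]`. [cite: Knapp2002, I §1] [cite: Macdonald1980, p. 93] -/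
theorem exists_basis_two_diag [MeasurableSpace (skewC 2 (Matrix.diagonal ![(1 : ℂ), -1]))] [BorelSpace (skewC 2 (Matrix.diagonal ![(1 : ℂ), -1]))] :
    ∃ B : Basis ((Fin 1 ⊕ Fin 1) ⊕ Fin 2) ℝ (skewC 2 (Matrix.diagonal ![(1 : ℂ), -1])),
      (∀ inst : DecidableEq ((Fin 1 ⊕ Fin 1) ⊕ Fin 2), @Matrix.det _ inst _ ℝ _ (lieGramC B) = 4) ∧
      B.addHaar = Measure.map (fun p : (ℝ × ℝ) × ℂ =>
        (⟨!![(p.1.1 : ℂ) * I, p.2; conj p.2, (p.1.2 : ℂ) * I], mem_skewC_two_diag p.1.1 p.1.2 p.2⟩ : skewC 2 (Matrix.diagonal ![(1 : ℂ), -1]))) volume := by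
  haveI : FiniteDimensional ℝ (Matrix (Fin 2) (Fin 2) ℂ) := finiteDimensional_matrixC
  -- the coordinate `ψ₋ : (ℝ × ℝ) × ℂ ≃L[ℝ] 𝔲(J₋)`
  let ψₗ : ((ℝ × ℝ) × ℂ) ≃ₗ[ℝ] skewC 2 (Matrix.diagonal ![(1 : ℂ), -1]) :=
    { toFun := fun p => ⟨!![(p.1.1 : ℂ) * I, p.2; conj p.2, (p.1.2 : ℂ) * I], mem_skewC_two_diag p.1.1 p.1.2 p.2⟩
      map_add' := fun p q => by
        apply Subtype.ext
        ext i j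
        fin_cases i <;> fin_cases j <;> simp <;> ring
      map_smul' := fun t p => by
        apply Subtype.ext
        ext i j
        fin_cases i <;> fin_cases j <;> simp [Complex.real_smul, Complex.conj_ofReal] <;> ring
      invFun := fun X => ((((X : Matrix (Fin 2) (Fin 2) ℂ) 0 0).im, ((X : Matrix (Fin 2) (Fin 2) ℂ) 1 1).im),
        (X : Matrix (Fin 2) (Fin 2) ℂ) 0 1)
      left_inv := fun p => by
        ext <;> simp
      right_inv := fun X => by
        apply Subtype.ext
        exact (eq_of_mem_skewC_two_diag X.2).symm }
  let ψ : ((ℝ × ℝ) × ℂ) ≃L[ℝ] skewC 2 (Matrix.diagonal ![(1 : ℂ), -1]) := ψₗ.toContinuousLinearEquiv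
  have hψ : ∀ p : (ℝ × ℝ) × ℂ, (ψ p : Matrix (Fin 2) (Fin 2) ℂ) = !![(p.1.1 : ℂ) * I, p.2; conj p.2, (p.1.2 : ℂ) * I] :=
    fun _ => rfl
  -- the coordinate basis
  set s₁ : Basis (Fin 1) ℝ ℝ := (OrthonormalBasis.singleton (Fin 1) ℝ).toBasis with hs₁
  set cI : Basis (Fin 2) ℝ ℂ := Complex.orthonormalBasisOneI.toBasis with hcI
  set bV : Basis ((Fin 1 ⊕ Fin 1) ⊕ Fin 2) ℝ ((ℝ × ℝ) × ℂ) := (s₁.prod s₁).prod cI with hbV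
  have hs₁v : s₁.addHaar = volume := (OrthonormalBasis.singleton (Fin 1) ℝ).addHaar_eq_volume
  have hcIv : cI.addHaar = volume := Complex.orthonormalBasisOneI.addHaar_eq_volume
  have hbVv : bV.addHaar = volume := by
    rw [hbV, Basis.prod_addHaar, Basis.prod_addHaar, hs₁v, hcIv, ← Measure.volume_eq_prod, ← Measure.volume_eq_prod]
  have hs₁a : ∀ i, s₁ i = 1 := fun i => by
    rw [hs₁, OrthonormalBasis.coe_toBasis, OrthonormalBasis.singleton_apply]
  have hcI0 : cI 0 = 1 := by rw [hcI, Complex.toBasis_orthonormalBasisOneI, Complex.coe_basisOneI]; rfl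
  have hcI1 : cI 1 = I := by rw [hcI, Complex.toBasis_orthonormalBasisOneI, Complex.coe_basisOneI]; rfl
  set B : Basis ((Fin 1 ⊕ Fin 1) ⊕ Fin 2) ℝ (skewC 2 (Matrix.diagonal ![(1 : ℂ), -1])) := bV.map ψₗ with hB
  have hB1 : ∀ i, (B (Sum.inl (Sum.inl i)) : Matrix (Fin 2) (Fin 2) ℂ) = !![I, 0; 0, 0] := by
    intro i
    rw [hB, Basis.map_apply]
    show (ψ (bV (Sum.inl (Sum.inl i))) : Matrix (Fin 2) (Fin 2) ℂ) = _
    rw [hψ, hbV, Basis.prod_apply, Sum.elim_inl, Function.comp_apply, Basis.prod_apply, Sum.elim_inl, Function.comp_apply, hs₁a]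
    simp
  have hB2 : ∀ i, (B (Sum.inl (Sum.inr i)) : Matrix (Fin 2) (Fin 2) ℂ) = !![0, 0; 0, I] := by
    intro i
    rw [hB, Basis.map_apply]
    show (ψ (bV (Sum.inl (Sum.inr i))) : Matrix (Fin 2) (Fin 2) ℂ) = _
    rw [hψ, hbV, Basis.prod_apply, Sum.elim_inl, Function.comp_apply, Basis.prod_apply, Sum.elim_inr, Function.comp_apply, hs₁a]
    simp
  have hB3 : (B (Sum.inr 0) : Matrix (Fin 2) (Fin 2) ℂ) = !![0, 1; 1, 0] := by
    rw [hB, Basis.map_apply]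
    show (ψ (bV (Sum.inr 0)) : Matrix (Fin 2) (Fin 2) ℂ) = _
    rw [hψ, hbV, Basis.prod_apply, Sum.elim_inr, Function.comp_apply, hcI0]
    simp
  have hB4 : (B (Sum.inr 1) : Matrix (Fin 2) (Fin 2) ℂ) = !![0, I; -I, 0] := by
    rw [hB, Basis.map_apply]
    show (ψ (bV (Sum.inr 1)) : Matrix (Fin 2) (Fin 2) ℂ) = _
    rw [hψ, hbV, Basis.prod_apply, Sum.elim_inr, Function.comp_apply, hcI1]
    simp
  refine ⟨B, ?_, ?_⟩
  · -- Gram matrix `diag(−1,−1,2,2)`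
    intro inst
    have hdiag : lieGramC B = Matrix.diagonal (Sum.elim (Sum.elim (fun _ : Fin 1 => (-1 : ℝ)) (fun _ : Fin 1 => -1)) ![2, 2]) := by
      ext i j
      rw [lieGramC_apply, traceFormC_apply]
      rcases i with ((i | i) | i) <;> rcases j with ((j | j) | j)
      all_goals fin_cases i <;> fin_cases j
      all_goals norm_num [hB1, hB2, hB3, hB4, Matrix.trace_fin_two, Matrix.diagonal, Sum.inl_ne_inr, Sum.inr_ne_inl]
    rw [hdiag, Matrix.det_diagonal]
    norm_num
  · have hmap : B.addHaar = (volume : Measure ((ℝ × ℝ) × ℂ)).map ψ := by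
      rw [← hbVv, Basis.map_addHaar _ ψ, hB]
      rfl
    rw [hmap]
    rfl

/-- **`N = 2`, `Jw = J₋`: THE GRAM DETERMINANT OF RECORD IS POSITIVE** (`= 4c²`: two negative `𝔨`-directions, two positive `𝔭`-directions).
[cite: Knapp2002, I §1] [cite: Helgason2000, Introduction §4] -/
theorem lieGramDetC_two_diag_pos : 0 < lieGramDetC 2 (Matrix.diagonal ![(1 : ℂ), -1]) := by
  letI : MeasurableSpace (skewC 2 (Matrix.diagonal ![(1 : ℂ), -1])) := borel _
  haveI : BorelSpace (skewC 2 (Matrix.diagonal ![(1 : ℂ), -1])) := ⟨rfl⟩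
  obtain ⟨B, hdet, -⟩ := exists_basis_two_diag
  rw [lieGramDetC_pos_iff B, hdet inferInstance]
  norm_num

/-- **`N = 2`, `Jw = J₋`: THE TOP-FORM LEBESGUE MEASURE OF `𝔲(1,1)` IS `2 · da db dz`** in the coordinates `(a, b, z) ↦ !![ia, z; z̄, ib]` (`√|4| = 2`) — the SAME factor
`2` as in the definite case: the Gram input of socket F9 does not depend on the signature of `h` at the complex place. [cite: Macdonald1980, p. 93] [cite: Rogawski1990, §1.7 p. 6] -/
theorem lieStdLebesgueC_two_diag_eq [MeasurableSpace (skewC 2 (Matrix.diagonal ![(1 : ℂ), -1]))] [BorelSpace (skewC 2 (Matrix.diagonal ![(1 : ℂ), -1]))] :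
    lieStdLebesgueC 2 (Matrix.diagonal ![(1 : ℂ), -1]) =
      ENNReal.ofReal 2 • Measure.map (fun p : (ℝ × ℝ) × ℂ =>
        (⟨!![(p.1.1 : ℂ) * I, p.2; conj p.2, (p.1.2 : ℂ) * I], mem_skewC_two_diag p.1.1 p.1.2 p.2⟩ : skewC 2 (Matrix.diagonal ![(1 : ℂ), -1]))) volume := by
  obtain ⟨B, hdet, hmap⟩ := exists_basis_two_diag
  rw [lieStdLebesgueC_eq_smul_addHaar B, hdet, hmap]
  norm_num

end TwoDiag

end Summit.HodgeConjecture.HodgeConjecture.Cruxes.H413.K2E5LieGramDetValueIndefinite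

end
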